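import Literature.NumberTheory.LFunctions.WeilWindowSuzukiAsymptoticProofs
import Literature.NumberTheory.LFunctions.WeilWindowSuzukiProofs
import Literature.NumberTheory.LFunctions.WeilGroundState
import Literature.NumberTheory.ConnesConsani2019.RiemannRochStrategy
import Literature.NumberTheory.LFunctions.WeilMellinInversion

/-!
# `Δ•Δ = −∞` in the decreed pairing: the diagonal of the Riemann–Roch strategy (motivic door, cc-3)

Honest framing (cell `pub-rhdoor`): lottery ticket at the motivic door; RH probability negligible;
consolation prizes are real: a new semi-local Weil-positivity theorem, or a located gap in the
Connes–Consani programme, plus the ff-door theorem.  This file has NO content about the zeros of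
`ζ`; it makes quantitative, in the tree's normalisation, a heuristic the authors state in print.

PRINTED.  Connes, *An essay on the Riemann Hypothesis* (arXiv:1509.05576): §2.3 p. 7 (Weil's
proof on `C̄ × C̄`: "the problem is then reduced to proving the negativity of `D.D` … for divisors of
degree zero; the Riemann–Roch theorem on the surface gives the answer"); §4.1 pp. 14–15 (the
would-be curve over `F₁` with zeta function `ζ_ℚ`: "as `N(1)` represents the Euler characteristic
one should expect that `N(1) = -∞` (since the dimension of `H¹` is infinite)", and
"`N(1) = 2 - lim_{ε→0} (ω(1+ε) - ω(1))/ε ∼ -½ E log E`, `E = 1/ε`, which is `-∞` and in fact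
reflects … the density of the zeros").  Connes–Consani, *The Riemann–Roch strategy*
(arXiv:1805.10501), §3: the divisors are `D(f) = ∫ f(λ) Ψ_λ d*λ` for test functions `f` on `ℝ₊*`,
with `D(f)•D(f') = 𝔰(f, f')` DECREED by the explicit formula (the diagonal is `Δ = Ψ₁ = D(δ₁)`).
DERIVED (shape match, not used in any proof): at concentration scale `E = 1+η` the bound of §3
below is `-E (log E - K) ‖u‖₂²`, the printed shape `-E log E`; here it comes from the archimedean
side of the explicit formula (the `log(1/a)` of the small-window law), there from the density of
zeros — the two sides of the same formula.

PROVED here (labels per declaration), with `𝔰`, `toMul`, the masses `∫ f d*u`, `∫ f du` of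
`Literature/NumberTheory/ConnesConsani2019/RiemannRochStrategy` (`2𝔰(f,f) = P(g) - Re Q(g)` for
`f = toMul u`, `g = u`, `two_mul_ccPairing_toMul_eq`) and the tree's small-window law of Suzuki
(arXiv:2606.09096 Thm. 1.4, `Suzuki2026_thm_1_4_asymptotic_holds`:
`ε(a) = log(1/a) + μ₁ - log 2π - γ + O(a)`, `ε(a) = weilGroundEnergy a`):

1. `exists_log_window_lower_bound`: there are `K` and `a₀ ∈ (0, 1]` with
   `Re Q(g) ≥ (log(1/a) - K) ‖g‖₂²` for every test `g` supported in `[-a, a]`, `0 < a ≤ a₀`.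
2. `exists_log_dilate_lower_bound`, `tendsto_re_weilQuadratic_weilDilate_atTop`: along the unitary
   dilations `g_η = weilDilate η g` (`‖g_η‖₂ = ‖g‖₂`, support shrinking like `(1+η)⁻¹`),
   `Re Q(g_η) ≥ (log(1+η) - K') ‖g‖₂² → +∞`; hence (`not_bddAbove_re_weilQuadratic_sphere`) Weil's
   form is UNBOUNDED ABOVE on the unit sphere of every window `[-a, a]` — the companion of the
   ground energy `ε(a) = inf` being finite.
3. `exists_two_mul_ccPairing_approxDiagonal_le`, `tendsto_ccPairing_approxDiagonal_atBot`: for a real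
   test `u ≢ 0` and the mass-preserving approximate identities `u_η(t) = (1+η) u((1+η)t)` — so that
   `f_η = toMul u_η → (∫u) · δ₁` and `D(f_η) → (∫u) · Δ` — the decreed self-intersection satisfies
   `2𝔰(f_η, f_η) ≤ (16 R - (1+η)(log(1+η) - K)) ‖u‖₂² → -∞`,
   while the Castelnuovo–Severi bound `2 (∫f_η d*u)(∫f_η du)` stays bounded (`|P(u_η)| ≤ 16 R ‖u‖₂²`,
   `abs_weilPoleForm_le`).  So in the decreed pairing the diagonal class has self-intersection `-∞`
   with infinite room under Castelnuovo–Severi: the divergence is the archimedean `log(1/a)` of the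
   small-window law (the place at infinity; `½|t| log|t|` of the screw function at `0`), i.e. the
   "`g = ∞`" of the Essay, now a theorem with a rate.
4. `weilMellin_approxDiagonal`, `tendsto_massDstar_approxDiagonal`, `tendsto_massDu_approxDiagonal`:
   `û_η(s) = û(½ + (s-½)/(1+η))`, so the bidegree `(∫f_η d*u, ∫f_η du) = (Re û_η(0), Re û_η(1))`
   tends to `(∫u, ∫u)` — the approximants do converge to `(∫u)·Δ` in bidegree — and
   (`eventually_ccPairing_neg_and_masses_pos`) for `∫u ≠ 0`, eventually
   `2𝔰(f_η,f_η) < 0 < 2(∫f_η d*u)(∫f_η du)`: Castelnuovo–Severi holds near the diagonal with a margin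
   tending to `+∞` (no RH content — the left side diverges).

DERIVED reading for the located gap (surface side, G3 of `LOCATED-GAP.md`): any Riemann–Roch /
intersection theory on a square of `Spec ℤ` reproducing `𝔰` must assign the diagonal self-intersection
`-∞` (or renormalise it), so the classical first step of Weil's proof — `Δ` an honest curve on the
surface with `Δ² = 2 - 2g` finite — has no counterpart before renormalisation; this is a constraint
on the missing object, not evidence about RH.

References: A. Connes, arXiv:1509.05576 §4.2; A. Connes, C. Consani, arXiv:1805.10501 §3;
M. Suzuki, arXiv:2606.09096 Thm. 1.4; E. Bombieri, Rend. Mat. Acc. Lincei (9) 11 (2000) Thm. 2;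
A. Weil, *Sur les courbes algébriques et les variétés qui s'en déduisent* (1948).
-/

noncomputable section

open Complex Set MeasureTheory Filter Topology Literature.NumberTheory.LFunctions
open Literature.NumberTheory.ConnesConsani2019

namespace Summit.RiemannHypothesis.RiemannHypothesis.Theorems.MotivicDoor.ConnesConsani

variable {g : ℝ → ℂ}

/-! ## 1. Small windows: `Re Q(g) ≥ (log(1/a) − K) ‖g‖₂²` -/

/-- **Small-window log law, pointwise form** (from Suzuki 2026 Thm. 1.4 as proved in the tree,
`Suzuki2026_thm_1_4_asymptotic_holds`, and the infimum property `weilGroundEnergy_le_div`): there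
are constants `K` and `a₀ ∈ (0, 1]` such that every Weil test function `g ≢ 0` supported in `[-a, a]`,
`0 < a ≤ a₀`, has `Re Q(g) ≥ (log(1/a) - K) ‖g‖₂²`.  PROVED. -/
theorem exists_log_window_lower_bound :
    ∃ K a₀ : ℝ, 0 < a₀ ∧ a₀ ≤ 1 ∧ ∀ a : ℝ, 0 < a → a ≤ a₀ → ∀ g : ℝ → ℂ, IsWeilTest g →
      tsupport g ⊆ Icc (-a) a → 0 < ∫ t, ‖g t‖ ^ 2 →
        (Real.log (1 / a) - K) * ∫ t, ‖g t‖ ^ 2 ≤ (weilQuadratic g).re := by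
  obtain ⟨μ₁, hμ₁, C, a₀, ha₀, h⟩ := Suzuki2026_thm_1_4_asymptotic_holds
  refine ⟨Real.log (2 * Real.pi) + Real.eulerMascheroniConstant + |C|, min a₀ 1,
    lt_min ha₀ one_pos, min_le_right _ _, fun a ha ha' g hg hsupp hpos ↦ ?_⟩
  have ha₀' : a ≤ a₀ := ha'.trans (min_le_left _ _)
  have ha1 : a ≤ 1 := ha'.trans (min_le_right _ _)
  have hε := h a ha ha₀'
  have hCa : C * a ≤ |C| := by
    calc C * a ≤ |C| * a := mul_le_mul_of_nonneg_right (le_abs_self C) ha.le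
      _ ≤ |C| * 1 := mul_le_mul_of_nonneg_left ha1 (abs_nonneg C)
      _ = |C| := mul_one _
  have hlow : Real.log (1 / a) - (Real.log (2 * Real.pi) + Real.eulerMascheroniConstant + |C|) ≤
      weilGroundEnergy a := by
    rw [abs_le] at hε
    linarith [hε.1]
  exact (le_div_iff₀ hpos).1 (hlow.trans (weilGroundEnergy_le_div hg hsupp hpos))

/-! ## 2. Unitary dilations: `Re Q(g_η) ≥ (log(1+η) − K) ‖g‖₂² → +∞` -/

/-- **Log divergence along unitary dilations.**  For a test `g ≢ 0` supported in `[-R, R]` and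
`g_η = weilDilate η g = (1+η)^{1/2} g((1+η)·)` (`‖g_η‖₂ = ‖g‖₂`, `supp g_η ⊆ [-R/(1+η), R/(1+η)]`):
`Re Q(g_η) ≥ (log(1+η) - K) ‖g‖₂²` for all `η ≥ η₀`.  PROVED. -/
theorem exists_log_dilate_lower_bound (hg : IsWeilTest g) {R : ℝ} (hR : 0 < R)
    (hsupp : tsupport g ⊆ Icc (-R) R) (hpos : 0 < ∫ t, ‖g t‖ ^ 2) :
    ∃ K η₀ : ℝ, 0 ≤ η₀ ∧ ∀ η : ℝ, η₀ ≤ η →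
      (Real.log (1 + η) - K) * ∫ t, ‖g t‖ ^ 2 ≤ (weilQuadratic (weilDilate η g)).re := by
  obtain ⟨K, a₀, ha₀, -, h⟩ := exists_log_window_lower_bound
  refine ⟨K + Real.log R, max 0 (R / a₀ - 1), le_max_left _ _, fun η hη ↦ ?_⟩
  have hη0 : 0 ≤ η := (le_max_left _ _).trans hη
  have hη1 : -1 < η := by linarith
  have hc : 0 < 1 + η := by linarith
  have hRa : R / a₀ - 1 ≤ η := (le_max_right _ _).trans hη
  have ha : 0 < R / (1 + η) := div_pos hR hc
  have haa₀ : R / (1 + η) ≤ a₀ := by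
    rw [div_le_iff₀ hc]
    have h1 : R / a₀ ≤ 1 + η := by linarith
    have h2 : R = R / a₀ * a₀ := by field_simp
    rw [h2]
    calc R / a₀ * a₀ ≤ (1 + η) * a₀ := mul_le_mul_of_nonneg_right h1 ha₀.le
      _ = a₀ * (1 + η) := mul_comm _ _
  have hsupp' : tsupport (weilDilate η g) ⊆ Icc (-(R / (1 + η))) (R / (1 + η)) :=
    tsupport_weilDilate_subset g hη1 hsupp
  have hpos' : 0 < ∫ t, ‖weilDilate η g t‖ ^ 2 := by rwa [integral_norm_sq_weilDilate g hη1]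
  have hmain := h (R / (1 + η)) ha haa₀ (weilDilate η g) (hg.weilDilate hη1) hsupp' hpos'
  rw [integral_norm_sq_weilDilate g hη1] at hmain
  have hlog : Real.log (1 / (R / (1 + η))) = Real.log (1 + η) - Real.log R := by
    rw [one_div_div, Real.log_div hc.ne' hR.ne']
  rw [hlog] at hmain
  convert hmain using 2
  ring

/-- **`Re Q(g_η) → +∞`** along the unitary dilations of any test `g ≢ 0`.  PROVED. -/
theorem tendsto_re_weilQuadratic_weilDilate_atTop (hg : IsWeilTest g) {R : ℝ} (hR : 0 < R)
    (hsupp : tsupport g ⊆ Icc (-R) R) (hpos : 0 < ∫ t, ‖g t‖ ^ 2) :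
    Tendsto (fun η : ℝ ↦ (weilQuadratic (weilDilate η g)).re) atTop atTop := by
  obtain ⟨K, η₀, -, h⟩ := exists_log_dilate_lower_bound hg hR hsupp hpos
  have h1 : Tendsto (fun η : ℝ ↦ Real.log (1 + η)) atTop atTop :=
    Real.tendsto_log_atTop.comp (tendsto_atTop_add_const_left atTop 1 tendsto_id)
  have h2 : Tendsto (fun η : ℝ ↦ Real.log (1 + η) - K) atTop atTop := by
    simpa only [sub_eq_add_neg] using tendsto_atTop_add_const_right atTop (-K) h1
  have h3 : Tendsto (fun η : ℝ ↦ (Real.log (1 + η) - K) * ∫ t, ‖g t‖ ^ 2) atTop atTop :=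
    h2.atTop_mul_const hpos
  exact tendsto_atTop_mono' atTop (eventually_atTop.2 ⟨η₀, h⟩) h3

/-- **Weil's form is unbounded above on the unit sphere of every window**: for every `a > 0`,
`{Re Q(g) : g test, supp g ⊆ [-a, a], ‖g‖₂ = 1}` has no upper bound (dilate any unit test of the
window).  The companion statement to the finiteness of `ε(a) = inf` (`weilGroundEnergy`).  PROVED. -/
theorem not_bddAbove_re_weilQuadratic_sphere {a : ℝ} (ha : 0 < a) :
    ¬ BddAbove {x : ℝ | ∃ g : ℝ → ℂ, IsWeilTest g ∧ tsupport g ⊆ Icc (-a) a ∧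
      ∫ t, ‖g t‖ ^ 2 = (1 : ℝ) ∧ x = (weilQuadratic g).re} := by
  rintro ⟨M, hM⟩
  obtain ⟨g, hg, hsupp, hone⟩ := exists_isWeilTest_sphere ha
  have hpos : 0 < ∫ t, ‖g t‖ ^ 2 := by rw [hone]; exact one_pos
  have hT := tendsto_re_weilQuadratic_weilDilate_atTop hg ha hsupp hpos
  obtain ⟨η, hη, hη0⟩ :=
    ((hT.eventually (eventually_gt_atTop M)).and (eventually_ge_atTop (0 : ℝ))).exists
  have hη1 : -1 < η := by linarith
  have hle : a / (1 + η) ≤ a := div_le_self ha.le (by linarith)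
  have hmem : (weilQuadratic (weilDilate η g)).re ∈ {x : ℝ | ∃ g : ℝ → ℂ, IsWeilTest g ∧
      tsupport g ⊆ Icc (-a) a ∧ ∫ t, ‖g t‖ ^ 2 = (1 : ℝ) ∧ x = (weilQuadratic g).re} := by
    refine ⟨weilDilate η g, hg.weilDilate hη1, ?_, ?_, rfl⟩
    · exact (tsupport_weilDilate_subset g hη1 hsupp).trans
        (Icc_subset_Icc (neg_le_neg hle) hle)
    · rw [integral_norm_sq_weilDilate g hη1, hone]
  exact absurd (hM hmem) (not_le.2 hη)

/-! ## 3. The Connes–Consani reading: `Δ•Δ = −∞` in the decreed pairing -/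

section Diagonal

variable {u : ℝ → ℝ}

/-- The mass-preserving approximate identity `u_η(t) = (1+η) u((1+η) t)` is `(1+η)^{1/2}` times the
unitary dilation. -/
theorem ofReal_approxDiagonal_eq (u : ℝ → ℝ) {η : ℝ} (hη : -1 < η) :
    (fun t ↦ (((1 + η) * u ((1 + η) * t) : ℝ) : ℂ)) =
      fun t ↦ (Real.sqrt (1 + η) : ℂ) * weilDilate η (fun t ↦ (u t : ℂ)) t := by
  funext t
  simp only [weilDilate]
  rw [← mul_assoc, ← Complex.ofReal_mul, Real.mul_self_sqrt (by linarith : (0 : ℝ) ≤ 1 + η)]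
  push_cast
  ring

/-- `u_η` is a Weil test function. -/
theorem isWeilTest_approxDiagonal (hu : IsWeilTest fun t ↦ (u t : ℂ)) {η : ℝ} (hη : -1 < η) :
    IsWeilTest fun t ↦ (((1 + η) * u ((1 + η) * t) : ℝ) : ℂ) := by
  rw [ofReal_approxDiagonal_eq u hη]
  exact (hu.weilDilate hη).const_mul _

/-- `supp u_η ⊆ [-R/(1+η), R/(1+η)]`. -/
theorem tsupport_approxDiagonal_subset (u : ℝ → ℝ) {η R : ℝ} (hη : -1 < η)
    (hsupp : tsupport (fun t ↦ (u t : ℂ)) ⊆ Icc (-R) R) :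
    tsupport (fun t ↦ (((1 + η) * u ((1 + η) * t) : ℝ) : ℂ)) ⊆
      Icc (-(R / (1 + η))) (R / (1 + η)) := by
  rw [ofReal_approxDiagonal_eq u hη]
  exact (tsupport_mul_subset_right (f := fun _ : ℝ ↦ (Real.sqrt (1 + η) : ℂ))
    (g := weilDilate η fun t ↦ (u t : ℂ))).trans (tsupport_weilDilate_subset _ hη hsupp)

/-- `‖u_η‖₂² = (1+η) ‖u‖₂²`. -/
theorem integral_norm_sq_approxDiagonal (u : ℝ → ℝ) {η : ℝ} (hη : -1 < η) :
    ∫ t, ‖(((1 + η) * u ((1 + η) * t) : ℝ) : ℂ)‖ ^ 2 = (1 + η) * ∫ t, ‖(u t : ℂ)‖ ^ 2 := by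
  have e := congrFun (ofReal_approxDiagonal_eq u hη)
  simp only [e, norm_mul, mul_pow, Complex.norm_real, Real.norm_of_nonneg (Real.sqrt_nonneg _),
    Real.sq_sqrt (by linarith : (0 : ℝ) ≤ 1 + η), integral_const_mul,
    integral_norm_sq_weilDilate _ hη]

/-- `Re Q(u_η) = (1+η) Re Q(weilDilate η u)` (homogeneity of `Q`). -/
theorem re_weilQuadratic_approxDiagonal (u : ℝ → ℝ) {η : ℝ} (hη : -1 < η) :
    (weilQuadratic fun t ↦ (((1 + η) * u ((1 + η) * t) : ℝ) : ℂ)).re =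
      (1 + η) * (weilQuadratic (weilDilate η fun t ↦ (u t : ℂ))).re := by
  rw [ofReal_approxDiagonal_eq u hη, weilQuadratic_const_mul, Complex.normSq_ofReal,
    Real.mul_self_sqrt (by linarith : (0 : ℝ) ≤ 1 + η), Complex.re_ofReal_mul]

/-- **`Δ•Δ = −∞`, quantitatively.**  For a real test `u ≢ 0` supported in `[-R, R]` and its
mass-preserving approximate identities `u_η(t) = (1+η) u((1+η)t)` (so `f_η = toMul u_η → (∫u)·δ₁`
and `D(f_η) → (∫u)·Δ` in the Connes–Consani dictionary), the DECREED self-intersection satisfies,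
for all `η ≥ η₀`, `2𝔰(f_η, f_η) ≤ (16 R - (1+η)(log(1+η) - K)) ‖u‖₂²`
(`2𝔰 = P - Re Q`, `two_mul_ccPairing_toMul_eq`; `|P(u_η)| ≤ 16 (R/(1+η)) ‖u_η‖₂² = 16 R ‖u‖₂²`,
`abs_weilPoleForm_le`; `Re Q(u_η) = (1+η) Re Q(weilDilate η u) ≥ (1+η)(log(1+η) - K)‖u‖₂²`).  PROVED. -/
theorem exists_two_mul_ccPairing_approxDiagonal_le (hu : IsWeilTest fun t ↦ (u t : ℂ)) {R : ℝ}
    (hR : 0 < R) (hsupp : tsupport (fun t ↦ (u t : ℂ)) ⊆ Icc (-R) R)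
    (hpos : 0 < ∫ t, ‖(u t : ℂ)‖ ^ 2) :
    ∃ K η₀ : ℝ, 0 ≤ η₀ ∧ ∀ η : ℝ, η₀ ≤ η →
      2 * ccPairing (toMul fun t ↦ (1 + η) * u ((1 + η) * t))
          (toMul fun t ↦ (1 + η) * u ((1 + η) * t)) ≤
        (16 * R - (1 + η) * (Real.log (1 + η) - K)) * ∫ t, ‖(u t : ℂ)‖ ^ 2 := by
  obtain ⟨K, η₀, hη₀, h⟩ := exists_log_dilate_lower_bound hu hR hsupp hpos
  refine ⟨K, max η₀ (R - 1), hη₀.trans (le_max_left _ _), fun η hη ↦ ?_⟩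
  have hη' : η₀ ≤ η := (le_max_left _ _).trans hη
  have hη0 : 0 ≤ η := hη₀.trans hη'
  have hη1 : -1 < η := by linarith
  have hc : 0 < 1 + η := by linarith
  have hRη : R - 1 ≤ η := (le_max_right _ _).trans hη
  set N : ℝ := ∫ t, ‖(u t : ℂ)‖ ^ 2 with hN
  -- the decreed self-intersection is `P - Re Q`
  rw [two_mul_ccPairing_toMul_eq (isWeilTest_approxDiagonal hu hη1),
    re_weilQuadratic_approxDiagonal u hη1]
  -- the pole form is bounded: `|P(u_η)| ≤ 16 (R/(1+η)) ‖u_η‖₂² = 16 R ‖u‖₂²`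
  have ha : 0 < R / (1 + η) := div_pos hR hc
  have ha1 : R / (1 + η) ≤ 1 := by rw [div_le_one hc]; linarith
  have hP := abs_weilPoleForm_le (isWeilTest_approxDiagonal hu hη1) ha ha1
    (tsupport_approxDiagonal_subset u hη1 hsupp)
  rw [integral_norm_sq_approxDiagonal u hη1, abs_le] at hP
  have hP' : weilPoleForm (fun t ↦ (((1 + η) * u ((1 + η) * t) : ℝ) : ℂ)) ≤ 16 * R * N := by
    have e : 16 * (R / (1 + η)) * ((1 + η) * N) = 16 * R * N := by field_simp
    linarith [hP.2]
  -- the Weil functional diverges: `Re Q(weilDilate η u) ≥ (log(1+η) - K) ‖u‖₂²`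
  have hQ := h η hη'
  have hQ' : (1 + η) * ((Real.log (1 + η) - K) * N) ≤
      (1 + η) * (weilQuadratic (weilDilate η fun t ↦ (u t : ℂ))).re :=
    mul_le_mul_of_nonneg_left hQ hc.le
  nlinarith [hP', hQ']

/-- **`Δ•Δ = −∞`**: the decreed self-intersections of the approximants of the diagonal tend to `-∞`
(while their Castelnuovo–Severi bounds `2 (∫f_η d*u)(∫f_η du) = P(u_η)` stay bounded by
`16 R ‖u‖₂²`).  PROVED. -/
theorem tendsto_ccPairing_approxDiagonal_atBot (hu : IsWeilTest fun t ↦ (u t : ℂ)) {R : ℝ}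
    (hR : 0 < R) (hsupp : tsupport (fun t ↦ (u t : ℂ)) ⊆ Icc (-R) R)
    (hpos : 0 < ∫ t, ‖(u t : ℂ)‖ ^ 2) :
    Tendsto (fun η : ℝ ↦ ccPairing (toMul fun t ↦ (1 + η) * u ((1 + η) * t))
      (toMul fun t ↦ (1 + η) * u ((1 + η) * t))) atTop atBot := by
  obtain ⟨K, η₀, -, h⟩ := exists_two_mul_ccPairing_approxDiagonal_le hu hR hsupp hpos
  set N : ℝ := ∫ t, ‖(u t : ℂ)‖ ^ 2 with hN
  -- `(1+η)(log(1+η) - K) N → +∞`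
  have h1 : Tendsto (fun η : ℝ ↦ 1 + η) atTop atTop := tendsto_atTop_add_const_left atTop 1 tendsto_id
  have h1' : Tendsto (fun η : ℝ ↦ Real.log (1 + η)) atTop atTop := Real.tendsto_log_atTop.comp h1
  have h2 : Tendsto (fun η : ℝ ↦ Real.log (1 + η) - K) atTop atTop := by
    simpa only [sub_eq_add_neg] using tendsto_atTop_add_const_right atTop (-K) h1'
  have h3 : Tendsto (fun η : ℝ ↦ (1 + η) * (Real.log (1 + η) - K) * N) atTop atTop :=
    (h1.atTop_mul_atTop₀ h2).atTop_mul_const hpos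
  -- hence the upper bound `16 R N - (1+η)(log(1+η) - K) N → -∞`
  have h4 : Tendsto (fun η : ℝ ↦ 16 * R * N + -((1 + η) * (Real.log (1 + η) - K) * N))
      atTop atBot :=
    tendsto_atBot_add_const_left atTop (16 * R * N) (tendsto_neg_atTop_atBot.comp h3)
  have h5 : Tendsto (fun η : ℝ ↦ 2 * ccPairing (toMul fun t ↦ (1 + η) * u ((1 + η) * t))
      (toMul fun t ↦ (1 + η) * u ((1 + η) * t))) atTop atBot := by
    refine tendsto_atBot_mono' atTop (eventually_atTop.2 ⟨η₀, fun η hη ↦ ?_⟩) h4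
    have := h η hη
    have e : (16 * R - (1 + η) * (Real.log (1 + η) - K)) * N =
        16 * R * N + -((1 + η) * (Real.log (1 + η) - K) * N) := by ring
    linarith
  have h6 := h5.atBot_div_const (two_pos : (0 : ℝ) < 2)
  refine h6.congr fun η ↦ ?_
  ring

end Diagonal

/-! ## 4. The approximants converge to `(∫u)·Δ`: bidegree `(d⋆(f_η), d_u(f_η)) → (∫u, ∫u)` -/

section Bidegree

variable {u : ℝ → ℝ}

/-- Mellin transform of the approximants: `û_η(s) = û(½ + (s − ½)/(1+η))`. -/
theorem weilMellin_approxDiagonal (u : ℝ → ℝ) {η : ℝ} (hη : -1 < η) (s : ℂ) :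
    weilMellin (fun t ↦ (((1 + η) * u ((1 + η) * t) : ℝ) : ℂ)) s =
      weilMellin (fun t ↦ (u t : ℂ)) (1 / 2 + (s - 1 / 2) / ((1 + η : ℝ) : ℂ)) := by
  have hc : (0 : ℝ) < 1 + η := by linarith
  have hc' : ((1 + η : ℝ) : ℂ) ≠ 0 := by exact_mod_cast hc.ne'
  rw [ofReal_approxDiagonal_eq u hη, weilMellin_const_mul, weilMellin_weilDilate _ hη, ← mul_assoc,
    ← mul_assoc, ← Complex.ofReal_mul, Real.mul_self_sqrt hc.le, mul_inv_cancel₀ hc', one_mul]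

/-- `∫ f_η d*u = Re û(½ − 1/(2(1+η)))` for `f_η = toMul u_η`. -/
theorem massDstar_toMul_approxDiagonal (u : ℝ → ℝ) {η : ℝ} (hη : -1 < η) :
    massDstar (toMul fun t ↦ (1 + η) * u ((1 + η) * t)) =
      (weilMellin (fun t ↦ (u t : ℂ)) (1 / 2 + (0 - 1 / 2) / ((1 + η : ℝ) : ℂ))).re := by
  have h := weilMellin_zero_eq_massDstar (fun t ↦ (1 + η) * u ((1 + η) * t))
  rw [← weilMellin_approxDiagonal u hη 0, h, Complex.ofReal_re]

/-- `∫ f_η du = Re û(½ + 1/(2(1+η)))` for `f_η = toMul u_η`. -/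
theorem massDu_toMul_approxDiagonal (u : ℝ → ℝ) {η : ℝ} (hη : -1 < η) :
    massDu (toMul fun t ↦ (1 + η) * u ((1 + η) * t)) =
      (weilMellin (fun t ↦ (u t : ℂ)) (1 / 2 + (1 - 1 / 2) / ((1 + η : ℝ) : ℂ))).re := by
  have h := weilMellin_one_eq_massDu (fun t ↦ (1 + η) * u ((1 + η) * t))
  rw [← weilMellin_approxDiagonal u hη 1, h, Complex.ofReal_re]

/-- `Re û(½ + c/(1+η)) → ∫ u` as `η → ∞` (`û` is continuous, `û(½) = ∫ u`). -/
theorem tendsto_re_weilMellin_half_add_div (hu : IsWeilTest fun t ↦ (u t : ℂ)) (c : ℂ) :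
    Tendsto (fun η : ℝ ↦ (weilMellin (fun t ↦ (u t : ℂ)) (1 / 2 + c / ((1 + η : ℝ) : ℂ))).re)
      atTop (𝓝 (∫ t, u t)) := by
  have h1 : Tendsto (fun η : ℝ ↦ 1 + η) atTop atTop := tendsto_atTop_add_const_left atTop 1 tendsto_id
  -- `((1+η) : ℂ)⁻¹ → 0`
  have h2 : Tendsto (fun η : ℝ ↦ ((1 + η : ℝ) : ℂ)⁻¹) atTop (𝓝 0) := by
    have h := (tendsto_inv_atTop_zero.comp h1)
    have h' : Tendsto (fun η : ℝ ↦ (((1 + η)⁻¹ : ℝ) : ℂ)) atTop (𝓝 ((0 : ℝ) : ℂ)) :=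
      (Complex.continuous_ofReal.tendsto 0).comp h
    simpa [Complex.ofReal_inv] using h'
  have h3 : Tendsto (fun η : ℝ ↦ (1 / 2 : ℂ) + c / ((1 + η : ℝ) : ℂ)) atTop (𝓝 (1 / 2)) := by
    have := (tendsto_const_nhds (x := c)).mul h2
    simpa [div_eq_mul_inv] using (tendsto_const_nhds (x := (1 / 2 : ℂ))).add this
  have h4 := ((continuous_weilMellin hu.1.continuous hu.2).tendsto (1 / 2)).comp h3
  have h5 := (Complex.continuous_re.tendsto _).comp h4
  have hhalf : (weilMellin (fun t ↦ (u t : ℂ)) (1 / 2)).re = ∫ t, u t := by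
    simp only [weilMellin, sub_self, zero_mul, Complex.exp_zero, mul_one, integral_complex_ofReal,
      Complex.ofReal_re]
  rw [hhalf] at h5
  exact h5

/-- **Bidegree of the approximants tends to `(∫u, ∫u)`**: `∫ f_η d*u → ∫ u`.  PROVED. -/
theorem tendsto_massDstar_approxDiagonal (hu : IsWeilTest fun t ↦ (u t : ℂ)) :
    Tendsto (fun η : ℝ ↦ massDstar (toMul fun t ↦ (1 + η) * u ((1 + η) * t))) atTop
      (𝓝 (∫ t, u t)) := by
  refine (tendsto_re_weilMellin_half_add_div hu (0 - 1 / 2)).congr' ?_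
  filter_upwards [eventually_gt_atTop (-1 : ℝ)] with η hη
  exact (massDstar_toMul_approxDiagonal u hη).symm

/-- **Bidegree of the approximants tends to `(∫u, ∫u)`**: `∫ f_η du → ∫ u`.  PROVED. -/
theorem tendsto_massDu_approxDiagonal (hu : IsWeilTest fun t ↦ (u t : ℂ)) :
    Tendsto (fun η : ℝ ↦ massDu (toMul fun t ↦ (1 + η) * u ((1 + η) * t))) atTop
      (𝓝 (∫ t, u t)) := by
  refine (tendsto_re_weilMellin_half_add_div hu (1 - 1 / 2)).congr' ?_
  filter_upwards [eventually_gt_atTop (-1 : ℝ)] with η hη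
  exact (massDu_toMul_approxDiagonal u hη).symm

/-- **Castelnuovo–Severi with diverging margin at the diagonal.**  If `∫ u ≠ 0` then, eventually in
`η`, the approximants `f_η` of `(∫u)·Δ` satisfy `2𝔰(f_η,f_η) < 0 < 2 (∫f_η d*u)(∫f_η du)`: the decreed
self-intersection tends to `-∞` while the Castelnuovo–Severi bound tends to `2(∫u)² > 0`.  PROVED
(no RH content: positivity of `W` on small windows is classical, here it is not even used — the
left side diverges). -/
theorem eventually_ccPairing_neg_and_masses_pos (hu : IsWeilTest fun t ↦ (u t : ℂ)) {R : ℝ}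
    (hR : 0 < R) (hsupp : tsupport (fun t ↦ (u t : ℂ)) ⊆ Icc (-R) R) (hm : ∫ t, u t ≠ 0) :
    ∀ᶠ η : ℝ in atTop,
      2 * ccPairing (toMul fun t ↦ (1 + η) * u ((1 + η) * t))
          (toMul fun t ↦ (1 + η) * u ((1 + η) * t)) < 0 ∧
        0 < 2 * (massDstar (toMul fun t ↦ (1 + η) * u ((1 + η) * t)) *
          massDu (toMul fun t ↦ (1 + η) * u ((1 + η) * t))) := by
  have hpos : 0 < ∫ t, ‖(u t : ℂ)‖ ^ 2 := by
    -- `∫ u ≠ 0` forces `u ≢ 0`, hence `‖u‖₂ > 0`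
    by_contra h0
    have hle : ∫ t, ‖(u t : ℂ)‖ ^ 2 ≤ 0 := not_lt.1 h0
    have hint : Integrable (fun t ↦ ‖(u t : ℂ)‖ ^ 2) := (hu.memLp_two).integrable_norm_pow two_ne_zero
      |>.congr (by simp)
    have hz : (fun t ↦ ‖(u t : ℂ)‖ ^ 2) =ᵐ[volume] 0 :=
      (integral_eq_zero_iff_of_nonneg (fun t ↦ by positivity) hint).1
        (le_antisymm hle (integral_nonneg fun t ↦ by positivity))
    have hz' : (fun t ↦ u t) =ᵐ[volume] 0 := by
      filter_upwards [hz] with t ht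
      simpa [Complex.norm_real] using ht
    exact hm (by rw [integral_congr_ae hz', Pi.zero_def, integral_zero])
  have h1 := tendsto_ccPairing_approxDiagonal_atBot hu hR hsupp hpos
  have h2 := (tendsto_massDstar_approxDiagonal hu).mul (tendsto_massDu_approxDiagonal hu)
  have hmm : 0 < (∫ t, u t) * ∫ t, u t := mul_self_pos.2 hm
  filter_upwards [h1.eventually (eventually_lt_atBot (0 : ℝ)),
    h2.eventually (eventually_gt_nhds hmm)] with η ha hb
  exact ⟨by linarith, by linarith⟩

end Bidegree

end Summit.RiemannHypothesis.RiemannHypothesis.Theorems.MotivicDoor.ConnesConsani
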